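import Summits.BirchSwinnertonDyer.BirchSwinnertonDyer.Theorems.PrintCFramBottomClassIndexLawFiveLeHerbrandRationalTransport

/-!
# Road C, stub D (Galois half), file 3: the lift `g ∈ Aut(M̄/F)` of `γ ∈ Γ_F` realising the outer action
# `absGaloisOuterConj F M γ` by genuine conjugation (w8 g0's `hconj` currency)

Summit `BirchSwinnertonDyer`, crux `PrintCFram.BottomClassIndexLawFiveLe` (stmt-BirchSwinnertonDyer-20372), line
`eisenstein-resource-bdp-line`, Stub H′; width seat `bsd-line-cfram-p1-w4` g5, typing item «D-gal» of LEAD g9's ROAD C (sequel of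
`…HerbrandRationalTransport.lean`).  HONEST FRAMING: Galois bookkeeping only; no summit statement is proved here, no stub is closed.

THE TWO CURRENCIES.  My transports (`…HerbrandRationalTransport.lean`) deliver a character `κ` of `Γ_M` with the law
`κ (absGaloisOuterConj F M γ σ) = κ σ ^ (r γ).val` (`θ_γ σ = res⁻¹(γ · res σ · γ⁻¹)`, the tree's outer action).  w8 g0's stub-E core
(`HerbrandKummer.exists_normalised_field_of_character`, STATUS 18:10Z) wants instead, for each `σ ∈ Gal(M/F)`, an automorphism
`g : M̄ ≃ₐ[F] M̄` lifting `σ` with `∀ n n' : Γ_M, (∀ x, g (n' • x) = n • g x) → κ n' = κ n ^ m σ`.  This file provides the lift: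
for `γ ∈ Γ_F` the automorphism `g = ι ∘ γ ∘ ι⁻¹` of `M̄` (`ι = absClosureEquiv F M : F̄ ≅ M̄`, the tree's chosen isomorphism) lifts
`γ̄ = absGaloisQuot F M γ` and conjugates `n' ∈ Γ_M` to `θ_γ n'`:

* `conjLift_absClosureEmbedding` (`g (ι y) = ι (γ • y)`), **`exists_conjLift`**: `∃ g : M̄ ≃ₐ[F] M̄`, (i) `g (x) = γ̄ x` on `M`,
  (ii) `g (n' • x) = θ_γ n' • g x`, (iii) `(∀ x, g (n' • x) = n • g x) → n = θ_γ n'`;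
* **`character_conj_law_of_outerConj_law`**: from the outer-action law of a character `κ : Γ_M →* A`
  (`κ (θ_γ σ) = κ σ ^ e γ`, `κ (θ_{γ⁻¹} σ) = κ σ ^ e' γ`) to w8's form `∃ g` lifting `γ̄` with `κ n' = κ n ^ e' γ` whenever `g ∘ n' = n ∘ g`;
* **`forall_gal_exists_conjLift`**: the same indexed by `σ ∈ Gal(M/F)` (every `σ` is some `γ̄`, `absGaloisQuot_surjective`), with the
  exponent `m σ := e' (a chosen lift of σ)`.

References: J. Neukirch, *Algebraic Number Theory*, Ch. IV §1 [NeukirchANT1999]; J.S. Milne, *Fields and Galois Theory*, §7;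
w8 g0's STATUS line 18:10Z 2026-08-28 (the `hconj` socket).
-/

noncomputable section

-- summit-side namespace `Summit.BirchSwinnertonDyer.BirchSwinnertonDyer.…` (single-conjunct summit, D-0017 layout)
set_option linter.dupNamespace false
set_option autoImplicit false

open scoped Classical Pointwise
open Field
open Literature.NumberTheory.GaloisRepresentations

namespace Summit.BirchSwinnertonDyer.BirchSwinnertonDyer.Theorems.PrintCFram.HerbrandSelmerToHom

section Lift

variable (F M : Type*) [Field F] [Field M] [Algebra F M] [IsGalois F M] [CharZero M]

omit [CharZero M] in
/-- `ι (γ • y) = g (ι y)` for `g = ι ∘ γ ∘ ι⁻¹`. [folklore] -/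
theorem conjLift_absClosureEmbedding (γ : absoluteGaloisGroup F) (y : AlgebraicClosure F) :
    (((absClosureEquiv F M).symm.trans (absoluteGaloisGroup.toAlgEquiv F γ)).trans (absClosureEquiv F M))
        (absClosureEmbedding F M y) = absClosureEmbedding F M (γ • y) := by
  rw [AlgEquiv.trans_apply, AlgEquiv.trans_apply, ← absClosureEquiv_apply, AlgEquiv.symm_apply_apply, absClosureEquiv_apply,
    absoluteGaloisGroup.smul_def]

/-- **The lift.** For `γ ∈ Γ_F` there is `g ∈ Aut(M̄/F)` which (i) restricts to `γ̄ = absGaloisQuot F M γ` on `M`, (ii) conjugates every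
`n' ∈ Γ_M` to `θ_γ n' = absGaloisOuterConj F M γ n'` (`g ∘ n' = θ_γ n' ∘ g`), and hence (iii) `g ∘ n' = n ∘ g ⟹ n = θ_γ n'`.
[cite: NeukirchANT1999, Ch. IV §1] -/
theorem exists_conjLift (γ : absoluteGaloisGroup F) :
    ∃ g : AlgebraicClosure M ≃ₐ[F] AlgebraicClosure M,
      (∀ x : M, g (algebraMap M (AlgebraicClosure M) x) = algebraMap M (AlgebraicClosure M) (absGaloisQuot F M γ x)) ∧
      (∀ (n' : absoluteGaloisGroup M) (x : AlgebraicClosure M), g (n' • x) = absGaloisOuterConj F M γ n' • g x) ∧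
      ∀ n n' : absoluteGaloisGroup M, (∀ x : AlgebraicClosure M, g (n' • x) = n • g x) → n = absGaloisOuterConj F M γ n' := by
  set g : AlgebraicClosure M ≃ₐ[F] AlgebraicClosure M :=
    ((absClosureEquiv F M).symm.trans (absoluteGaloisGroup.toAlgEquiv F γ)).trans (absClosureEquiv F M) with hg
  have hι : ∀ y : AlgebraicClosure F, g (absClosureEmbedding F M y) = absClosureEmbedding F M (γ • y) :=
    conjLift_absClosureEmbedding F M γ
  have hsurj : Function.Surjective (absClosureEmbedding F M) := (absClosureEmbedding_bijective F M).2
  have h2 : ∀ (n' : absoluteGaloisGroup M) (x : AlgebraicClosure M), g (n' • x) = absGaloisOuterConj F M γ n' • g x := by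
    intro n' x
    obtain ⟨y, rfl⟩ := hsurj x
    rw [← absGaloisRestrict_apply_smul, hι, hι, ← absGaloisRestrict_apply_smul, absGaloisRestrict_absGaloisOuterConj, mul_smul,
      mul_smul, inv_smul_smul]
  refine ⟨g, fun x => ?_, h2, fun n n' h => ?_⟩
  · rw [← absClosureEmbedding_absEmbedding F M x, ← absClosureEmbedding_absEmbedding F M, hι, absEmbedding_absGaloisQuot_apply]
  · refine (FaithfulSMul.eq_of_smul_eq_smul fun z : AlgebraicClosure M => ?_).symm
    obtain ⟨x, rfl⟩ := g.surjective z
    rw [← h2, h x]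

variable {F M}

/-- **From the outer-action law to w8 g0's conjugation law.** If a character `κ` of `Γ_M` satisfies `κ (θ_{γ⁻¹} σ) = κ σ ^ e` then, for the
lift `g` of `γ`, `κ n' = κ n ^ e` whenever `g ∘ n' = n ∘ g`. [cite: NeukirchANT1999, Ch. IV §1] -/
theorem exists_conjLift_character_law {A : Type*} [CommGroup A] (κ : absoluteGaloisGroup M →* A) (γ : absoluteGaloisGroup F) (e : ℕ)
    (hκ : ∀ σ : absoluteGaloisGroup M, κ (absGaloisOuterConj F M γ⁻¹ σ) = κ σ ^ e) :
    ∃ g : AlgebraicClosure M ≃ₐ[F] AlgebraicClosure M,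
      (∀ x : M, g (algebraMap M (AlgebraicClosure M) x) = algebraMap M (AlgebraicClosure M) (absGaloisQuot F M γ x)) ∧
      ∀ n n' : absoluteGaloisGroup M, (∀ x : AlgebraicClosure M, g (n' • x) = n • g x) → κ n' = κ n ^ e := by
  obtain ⟨g, h1, -, h3⟩ := exists_conjLift F M γ
  refine ⟨g, h1, fun n n' h => ?_⟩
  rw [h3 n n' h, ← hκ, absGaloisOuterConj_inv_apply_apply]

/-- **w8 g0's `hconj`, indexed by `σ ∈ Gal(M/F)`.** Given a character `κ` of `Γ_M` with `κ (θ_γ σ) = κ σ ^ e γ` for all `γ ∈ Γ_F`, there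
is an exponent function `m : Gal(M/F) → ℕ` (namely `m σ = e (γ_σ⁻¹)` for a lift `γ_σ` of `σ`) such that every `σ` has a lift
`g ∈ Aut(M̄/F)` with `κ n' = κ n ^ m σ` whenever `g ∘ n' = n ∘ g`; moreover `m (γ̄) = e(δ⁻¹)` for some `δ` with `δ̄ = γ̄`.
[cite: NeukirchANT1999, Ch. IV §1] -/
theorem exists_exponent_forall_gal_exists_conjLift {A : Type*} [CommGroup A] (κ : absoluteGaloisGroup M →* A)
    (e : absoluteGaloisGroup F → ℕ) (hκ : ∀ (γ : absoluteGaloisGroup F) (σ : absoluteGaloisGroup M), κ (absGaloisOuterConj F M γ σ) = κ σ ^ e γ) :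
    ∃ m : (M ≃ₐ[F] M) → ℕ,
      (∀ σ : M ≃ₐ[F] M, ∃ δ : absoluteGaloisGroup F, absGaloisQuot F M δ = σ ∧ m σ = e δ⁻¹) ∧
      ∀ σ : M ≃ₐ[F] M, ∃ g : AlgebraicClosure M ≃ₐ[F] AlgebraicClosure M,
        (∀ x : M, g (algebraMap M (AlgebraicClosure M) x) = algebraMap M (AlgebraicClosure M) (σ x)) ∧
        ∀ n n' : absoluteGaloisGroup M, (∀ x : AlgebraicClosure M, g (n' • x) = n • g x) → κ n' = κ n ^ m σ := by
  choose lift hlift using absGaloisQuot_surjective F M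
  refine ⟨fun σ => e (lift σ)⁻¹, fun σ => ⟨lift σ, hlift σ, rfl⟩, fun σ => ?_⟩
  obtain ⟨g, h1, h2⟩ := exists_conjLift_character_law κ (lift σ) (e (lift σ)⁻¹) (fun τ => hκ _ τ)
  refine ⟨g, fun x => ?_, h2⟩
  rw [h1, hlift]

/-- The exponent at `σ = γ̄` may be taken to be `e(γ⁻¹)` directly (no choice): `κ n' = κ n ^ e(γ⁻¹)` for the lift of `γ`.
[cite: NeukirchANT1999, Ch. IV §1] -/
theorem exists_conjLift_character_law' {A : Type*} [CommGroup A] (κ : absoluteGaloisGroup M →* A)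
    (e : absoluteGaloisGroup F → ℕ) (hκ : ∀ (γ : absoluteGaloisGroup F) (σ : absoluteGaloisGroup M), κ (absGaloisOuterConj F M γ σ) = κ σ ^ e γ)
    (γ : absoluteGaloisGroup F) :
    ∃ g : AlgebraicClosure M ≃ₐ[F] AlgebraicClosure M,
      (∀ x : M, g (algebraMap M (AlgebraicClosure M) x) = algebraMap M (AlgebraicClosure M) (absGaloisQuot F M γ x)) ∧
      ∀ n n' : absoluteGaloisGroup M, (∀ x : AlgebraicClosure M, g (n' • x) = n • g x) → κ n' = κ n ^ e γ⁻¹ :=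
  exists_conjLift_character_law κ γ (e γ⁻¹) fun σ => hκ γ⁻¹ σ

end Lift

end Summit.BirchSwinnertonDyer.BirchSwinnertonDyer.Theorems.PrintCFram.HerbrandSelmerToHom

end
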